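import Summits.ValiantsHypothesis.ValiantsHypothesis.Theorems.LacunarySymmetroidMatrixDescartesPivotRankOneFourKillSevenPairs

/-!
# `MatrixDescartes` census — rank-one `(2,4)₁`, chamber (B): the DIRECTION side of the covering theorem
# (two Plücker-type lemmas: on every direction configuration one of the five weight-free kill-seven certificates applies)

HONEST FRAMING.  Object-search cell `pub-symmetroid`, seat `val-sym-mdr-p1` (generation 15); helper file `--supports` the crux item
stmt-ValiantsHypothesis-18050 (`Theses.LacunarySymmetroid.MatrixDescartes`, OPEN, on HOLD) with NO closure claim.  Consumed by
`…PivotRankOneFourCover` (the covering theorem: rank-one `(2,4)₁` pencils in chamber (B) have `Z₊ ≤ 8`).  Nothing here bears on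
`MatrixDescartes` in its window, on `DoorA26` / `DoorA34`, registers / credences, or `VP ≠ VNP`.

WHAT.  In the hyperbolic frame of an indefinite `2 × 2` pivot (`J ≅ [[0,1],[1,0]]`, core letters `vₖ ∝ (1, tₖ)`, `tₖ > 0`) the five
weight-free kill-seven certificates of the kernel — (S) `…KillSeven`, (S′) `…KillSevenPrime`, (P) `…KillSevenPairs`, (P′) `…KillSevenInner`,
(T) `…KillSevenBottom` — read `ρ_X · R_X(t) ≤ 1` with
`R_S = t₁(t₃−t₀)²/(t₃(t₁−t₀)²)`, `R_S′ = t₁(t₃−t₀)²/(t₀(t₃−t₁)²)`, `R_P = (t₂−t₁)²(t₃−t₀)²/((t₁−t₀)²(t₃−t₂)²)`,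
`R_P′ = (t₂−t₁)²(t₃−t₀)²/((t₂−t₀)²(t₃−t₁)²)`, `R_T = 4t₀t₁/(t₁−t₀)²` and exponent constants `ρ_X = N_X/D_X`.
* `cover_P_or_Pprime`: if `ρ_P ≤ 1/16` and `ρ_P′ ≤ 1/4` then (P) or (P′) holds for EVERY `t` — because the three pairing products of
  four points on a line satisfy the Plücker relation `(t₁−t₀)(t₃−t₂) + (t₃−t₀)(t₂−t₁) = (t₂−t₀)(t₃−t₁)`, so
  `|(t₂−t₁)(t₃−t₀)| ≤ |(t₁−t₀)(t₃−t₂)| + |(t₂−t₀)(t₃−t₁)|`, while the failure of both certificates says the right side is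
  `< (1/4 + 1/2)·|(t₂−t₁)(t₃−t₀)|`.
* `cover_S_Sprime_T`: if `ρ_S ≤ 1/5000`, `ρ_S′ ≤ 3/25`, `ρ_S′ρ_T ≤ 1/16` then (S) or (S′) or (T) holds for every `t₀, t₁, t₃ > 0` — failure of
  (S) and (S′) forces (via `t₃ − t₀ = (t₃ − t₁) + (t₁ − t₀)`, with a split at `t₁ = 50 t₃`) the ratio `t₁/t₀` or `t₀/t₁` above
  `(81/100)/ρ_S′ ≥ 2 + 4ρ_T`, and then `(t₁ − t₀)² ≥ 4ρ_T t₀t₁`, i.e. (T).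
Both are stated with the constants as products `N_X, D_X` (the form the exponent file `…PivotRankOneFourCoverBounds` delivers).
Also here: the `B ≥ 0` variant of the kernel's four-nomial lemma and, on top of it, the (P) theorem with `D12 ≥ 0` (letters `1 ∥ 2`
allowed) — needed because the covering argument lands on (P) exactly when letters `1, 2` are parallel.

[folklore] Plücker relation / triangle inequality on a line; the kernel's kill engine (`…PivotTwoDirectionsBlockLaw`).  No definitions,
no named facts.
-/

-- `Summit.ValiantsHypothesis.ValiantsHypothesis.…` repeats a component by the D-0017 layout
-- (single-conjunct summit), which the `dupNamespace` linter flags; the name is mandated.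
set_option linter.dupNamespace false

namespace Summit.ValiantsHypothesis.ValiantsHypothesis.Theorems.LacunarySymmetroidMatrixDescartes.Pivot.TwoDirections.BlockLaw

open Polynomial Matrix Finset
open scoped BigOperators

/-! ## 1. The (P) certificate with `D12 ≥ 0` -/

/-- **Four-nomial lemma, `B ≥ 0` variant** of `BlockLaw.card_posRoots_fourNomial_le_one` (same proof).  For reals `A, C`, `B ≥ 0`, `D > 0` with `B·C ≤ A·D` and `g ≥ 1`, the polynomial
`A X^{n₀} − B X^{n₀+g} + C X^{n₀+h} − D X^{n₀+g+h}` has at most one positive root: a positive root satisfies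
`x^g = (A + C x^h)/(B + D x^h)`, whose left side is strictly increasing and right side non-increasing in `x`. [folklore] -/
theorem card_posRoots_fourNomial_le_one_of_nonneg (A B C D : ℝ) (hB : 0 ≤ B) (hD : 0 < D)
    (hBC : B * C ≤ A * D) (n₀ g h : ℕ) (hg : 1 ≤ g) :
    ((Polynomial.C A * X ^ n₀ - Polynomial.C B * X ^ (n₀ + g) + Polynomial.C C * X ^ (n₀ + h)
        - Polynomial.C D * X ^ (n₀ + g + h)).roots.toFinset.filter (fun t => 0 < t)).card ≤ 1 := by
  classical
  set Q := Polynomial.C A * X ^ n₀ - Polynomial.C B * X ^ (n₀ + g) + Polynomial.C C * X ^ (n₀ + h)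
        - Polynomial.C D * X ^ (n₀ + g + h) with hQ
  -- a positive root satisfies x^g (B + D x^h) = A + C x^h
  have key : ∀ x : ℝ, 0 < x → Q.eval x = 0 → x ^ g * (B + D * x ^ h) = A + C * x ^ h := by
    intro x hx hx0
    have hev : Q.eval x = x ^ n₀ * ((A + C * x ^ h) - x ^ g * (B + D * x ^ h)) := by
      simp only [hQ, eval_sub, eval_add, eval_mul, eval_C, eval_pow, eval_X, pow_add]
      ring
    rw [hev] at hx0
    rcases mul_eq_zero.1 hx0 with h0 | h0
    · exact absurd h0 (pow_ne_zero _ hx.ne')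
    · linarith
  -- two positive roots x < y are impossible
  have mono : ∀ x y : ℝ, 0 < x → x < y → Q.eval x = 0 → Q.eval y = 0 → False := by
    intro x y hx hxy hx0 hy0
    have hy : 0 < y := hx.trans hxy
    have ex := key x hx hx0
    have ey := key y hy hy0
    have hxh : x ^ h ≤ y ^ h := pow_le_pow_left₀ hx.le hxy.le h
    have hxg : x ^ g < y ^ g := pow_lt_pow_left₀ hxy hx.le (by omega)
    -- (A + C x^h)(B + D y^h) ≥ (A + C y^h)(B + D x^h)
    have cmp : (A + C * y ^ h) * (B + D * x ^ h) ≤ (A + C * x ^ h) * (B + D * y ^ h) := by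
      nlinarith [mul_nonneg (sub_nonneg.2 hBC) (sub_nonneg.2 hxh)]
    rw [← ex, ← ey] at cmp
    -- so y^g · P ≤ x^g · P with P = (B + D x^h)(B + D y^h) > 0
    have hPx : 0 < B + D * x ^ h := by positivity
    have hPy : 0 < B + D * y ^ h := by positivity
    have : y ^ g * ((B + D * y ^ h) * (B + D * x ^ h)) ≤ x ^ g * ((B + D * x ^ h) * (B + D * y ^ h)) := by
      nlinarith [cmp]
    have hP : 0 < (B + D * x ^ h) * (B + D * y ^ h) := mul_pos hPx hPy
    nlinarith [mul_lt_mul_of_pos_right hxg hP]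
  by_cases hQ0 : Q = 0
  · rw [hQ0]; simp
  refine Finset.card_le_one.2 fun x hx y hy => ?_
  rw [Finset.mem_filter, Multiset.mem_toFinset, mem_roots hQ0] at hx hy
  rcases lt_trichotomy x y with hlt | heq | hgt
  · exact (mono x y hx.2 hlt hx.1 hy.1).elim
  · exact heq
  · exact (mono y x hy.2 hgt hy.1 hx.1).elim



/-- **The eleven-nomial under `d₁ + d₂ < 2e` and the direction-only condition (P) has at most eight positive roots** (kept set
`{d₀+d₁, d₁+d₂, d₀+d₃, d₂+d₃}` — all PAIR terms — killed `2e, e+d₀, e+d₁, e+d₂, e+d₃, d₀+d₂, d₁+d₃`; weights positive, `D12 ≥ 0`, `D23 > 0`;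
(P): `D12·D03·Π(d₁+d₂)·Π(d₀+d₃) ≤ D01·D23·Π(d₀+d₁)·Π(d₂+d₃)` — no pairing with `J` enters).  VARIANT of the kernel's
`BlockLaw.elevenNomial_condP_le_eight` with `D12 ≥ 0` instead of `D12 > 0` (letters `1, 2` may be parallel; the killed four-nomial then has `B = 0`);
the proof is the kernel's, verbatim, on top of `card_posRoots_fourNomial_le_one_of_nonneg`. -/
theorem elevenNomial_condP_le_eight_of_nonneg (e d₀ d₁ d₂ d₃ : ℕ) (h01 : d₀ < d₁) (h1e : d₁ < e) (he2 : e < d₂) (h23 : d₂ < d₃)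
    (hB2 : d₁ + d₂ < 2 * e)
    (dJ m₀ m₁ m₂ m₃ w₀ w₁ w₂ w₃ D01 D02 D03 D12 D13 D23 : ℝ) (hw₀ : 0 < w₀) (hw₁ : 0 < w₁) (hw₂ : 0 < w₂) (hw₃ : 0 < w₃)
    (hD12 : 0 ≤ D12) (hD23 : 0 < D23)
    (hS : D12 * D03
        * (((d₁ : ℝ) + d₂ - e - d₀) * ((d₂ : ℝ) - e) * ((d₁ : ℝ) - d₀) * ((2 : ℝ) * e - d₁ - d₂) * ((e : ℝ) - d₁) * ((e : ℝ) + d₃ - d₁ - d₂) * ((d₃ : ℝ) - d₂))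
        * (((d₃ : ℝ) - e) * ((d₀ : ℝ) + d₃ - e - d₁) * ((d₃ : ℝ) - d₂) * ((d₀ : ℝ) + d₃ - 2 * e) * ((e : ℝ) + d₂ - d₀ - d₃) * ((d₁ : ℝ) - d₀) * ((e : ℝ) - d₀))
        ≤ D01 * D23
        * (((2 : ℝ) * e - d₀ - d₁) * ((e : ℝ) - d₁) * ((e : ℝ) - d₀) * ((e : ℝ) + d₂ - d₀ - d₁) * ((e : ℝ) + d₃ - d₀ - d₁) * ((d₂ : ℝ) - d₁) * ((d₃ : ℝ) - d₀))
        * (((d₂ : ℝ) + d₃ - 2 * e) * ((d₂ : ℝ) + d₃ - e - d₀) * ((d₂ : ℝ) + d₃ - e - d₁) * ((d₃ : ℝ) - e) * ((d₂ : ℝ) - e) * ((d₃ : ℝ) - d₀) * ((d₂ : ℝ) - d₁))) :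
    ((∑ i : Fin 11, Polynomial.C ((![dJ, w₀ * m₀, w₁ * m₁, w₂ * m₂, w₃ * m₃, w₀ * w₁ * D01, w₀ * w₂ * D02, w₀ * w₃ * D03, w₁ * w₂ * D12, w₁ * w₃ * D13, w₂ * w₃ * D23] : Fin 11 → ℝ) i) * X ^ ((![2 * e, e + d₀, e + d₁, e + d₂, e + d₃, d₀ + d₁, d₀ + d₂, d₀ + d₃, d₁ + d₂, d₁ + d₃, d₂ + d₃] : Fin 11 → ℕ) i)).roots.toFinset.filter (fun t => 0 < t)).card ≤ 8 := by
  classical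
  have h01' : (d₀ : ℝ) < d₁ := by exact_mod_cast h01
  have h1e' : (d₁ : ℝ) < e := by exact_mod_cast h1e
  have he2' : (e : ℝ) < d₂ := by exact_mod_cast he2
  have h23' : (d₂ : ℝ) < d₃ := by exact_mod_cast h23
  have hB2' : (d₁ : ℝ) + d₂ < 2 * e := by exact_mod_cast hB2
  -- the four distance products (positive atoms)
  obtain ⟨PA, hPA⟩ : ∃ x : ℝ, x = ((2 : ℝ) * e - d₀ - d₁) * ((e : ℝ) - d₁) * ((e : ℝ) - d₀) * ((e : ℝ) + d₂ - d₀ - d₁) * ((e : ℝ) + d₃ - d₀ - d₁) * ((d₂ : ℝ) - d₁) * ((d₃ : ℝ) - d₀) := ⟨_, rfl⟩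
  obtain ⟨PB, hPB⟩ : ∃ x : ℝ, x = ((d₁ : ℝ) + d₂ - e - d₀) * ((d₂ : ℝ) - e) * ((d₁ : ℝ) - d₀) * ((2 : ℝ) * e - d₁ - d₂) * ((e : ℝ) - d₁) * ((e : ℝ) + d₃ - d₁ - d₂) * ((d₃ : ℝ) - d₂) := ⟨_, rfl⟩
  obtain ⟨PC, hPC⟩ : ∃ x : ℝ, x = ((d₃ : ℝ) - e) * ((d₀ : ℝ) + d₃ - e - d₁) * ((d₃ : ℝ) - d₂) * ((d₀ : ℝ) + d₃ - 2 * e) * ((e : ℝ) + d₂ - d₀ - d₃) * ((d₁ : ℝ) - d₀) * ((e : ℝ) - d₀) := ⟨_, rfl⟩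
  obtain ⟨PD, hPD⟩ : ∃ x : ℝ, x = ((d₂ : ℝ) + d₃ - 2 * e) * ((d₂ : ℝ) + d₃ - e - d₀) * ((d₂ : ℝ) + d₃ - e - d₁) * ((d₃ : ℝ) - e) * ((d₂ : ℝ) - e) * ((d₃ : ℝ) - d₀) * ((d₂ : ℝ) - d₁) := ⟨_, rfl⟩
  have hS' : D12 * D03 * PB * PC ≤ D01 * D23 * PA * PD := by rw [hPA, hPB, hPC, hPD]; exact hS
  clear hS
  have hPBp : 0 < PB := by
    rw [hPB]
    have f1 : 0 < (d₁ : ℝ) + d₂ - e - d₀ := by linarith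
    have f2 : 0 < (d₂ : ℝ) - e := by linarith
    have f3 : 0 < (d₁ : ℝ) - d₀ := by linarith
    have f4 : 0 < (2 : ℝ) * e - d₁ - d₂ := by linarith
    have f5 : 0 < (e : ℝ) - d₁ := by linarith
    have f6 : 0 < (e : ℝ) + d₃ - d₁ - d₂ := by linarith
    have f7 : 0 < (d₃ : ℝ) - d₂ := by linarith
    exact mul_pos (mul_pos (mul_pos (mul_pos (mul_pos (mul_pos f1 f2) f3) f4) f5) f6) f7
  have hPDp : 0 < PD := by
    rw [hPD]
    have f1 : 0 < (d₂ : ℝ) + d₃ - 2 * e := by linarith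
    have f2 : 0 < (d₂ : ℝ) + d₃ - e - d₀ := by linarith
    have f3 : 0 < (d₂ : ℝ) + d₃ - e - d₁ := by linarith
    have f4 : 0 < (d₃ : ℝ) - e := by linarith
    have f5 : 0 < (d₂ : ℝ) - e := by linarith
    have f6 : 0 < (d₃ : ℝ) - d₀ := by linarith
    have f7 : 0 < (d₂ : ℝ) - d₁ := by linarith
    exact mul_pos (mul_pos (mul_pos (mul_pos (mul_pos (mul_pos f1 f2) f3) f4) f5) f6) f7
  -- the four surviving coefficients
  obtain ⟨A, hA⟩ : ∃ x : ℝ, x = w₀ * w₁ * D01 * PA := ⟨_, rfl⟩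
  obtain ⟨B, hB⟩ : ∃ x : ℝ, x = w₁ * w₂ * D12 * PB := ⟨_, rfl⟩
  obtain ⟨C, hC⟩ : ∃ x : ℝ, x = w₀ * w₃ * D03 * PC := ⟨_, rfl⟩
  obtain ⟨D, hD⟩ : ∃ x : ℝ, x = w₂ * w₃ * D23 * PD := ⟨_, rfl⟩
  have hBp : 0 ≤ B := by rw [hB]; exact mul_nonneg (mul_nonneg (mul_pos hw₁ hw₂).le hD12) hPBp.le
  have hDp : 0 < D := by rw [hD]; exact mul_pos (mul_pos (mul_pos hw₂ hw₃) hD23) hPDp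
  have hBC : B * C ≤ A * D := by
    have e1 : B * C = (w₀ * w₁ * w₂ * w₃) * (D12 * D03 * PB * PC) := by rw [hB, hC]; ring
    have e2 : A * D = (w₀ * w₁ * w₂ * w₃) * (D01 * D23 * PA * PD) := by rw [hA, hD]; ring
    rw [e1, e2]
    exact mul_le_mul_of_nonneg_left hS' (mul_pos (mul_pos (mul_pos hw₀ hw₁) hw₂) hw₃).le
  -- seven kills
  have hkills := card_posRoots_le_kills (Finset.univ : Finset (Fin 11)) (![2 * e, e + d₀, e + d₁, e + d₂, e + d₃, d₀ + d₁, d₀ + d₂, d₀ + d₃, d₁ + d₂, d₁ + d₃, d₂ + d₃] : Fin 11 → ℕ) [2 * e, e + d₀, e + d₁, e + d₂, e + d₃, d₀ + d₂, d₁ + d₃] (![dJ, w₀ * m₀, w₁ * m₁, w₂ * m₂, w₃ * m₃, w₀ * w₁ * D01, w₀ * w₂ * D02, w₀ * w₃ * D03, w₁ * w₂ * D12, w₁ * w₃ * D13, w₂ * w₃ * D23] : Fin 11 → ℝ)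
  -- the killed eleven-nomial is MINUS the four-nomial `A X^{d₀+d₁} − B X^{e+d₁} + C X^{d₀+d₃} − D X^{e+d₃}`
  have hfour : (∑ i ∈ (Finset.univ : Finset (Fin 11)), Polynomial.C ((![dJ, w₀ * m₀, w₁ * m₁, w₂ * m₂, w₃ * m₃, w₀ * w₁ * D01, w₀ * w₂ * D02, w₀ * w₃ * D03, w₁ * w₂ * D12, w₁ * w₃ * D13, w₂ * w₃ * D23] : Fin 11 → ℝ) i
          * (([2 * e, e + d₀, e + d₁, e + d₂, e + d₃, d₀ + d₂, d₁ + d₃]).map (fun ρ : ℕ => ((((![2 * e, e + d₀, e + d₁, e + d₂, e + d₃, d₀ + d₁, d₀ + d₂, d₀ + d₃, d₁ + d₂, d₁ + d₃, d₂ + d₃] : Fin 11 → ℕ) i : ℕ) : ℝ) - (ρ : ℝ)))).prod) * X ^ ((![2 * e, e + d₀, e + d₁, e + d₂, e + d₃, d₀ + d₁, d₀ + d₂, d₀ + d₃, d₁ + d₂, d₁ + d₃, d₂ + d₃] : Fin 11 → ℕ) i))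
      = -(Polynomial.C A * X ^ (d₀ + d₁) - Polynomial.C B * X ^ (d₀ + d₁ + (d₂ - d₀))
          + Polynomial.C C * X ^ (d₀ + d₁ + (d₃ - d₁)) - Polynomial.C D * X ^ (d₀ + d₁ + (d₂ - d₀) + (d₃ - d₁))) := by
    have e3 : d₀ + d₁ + (d₂ - d₀) + (d₃ - d₁) = d₂ + d₃ := by omega
    have e1 : d₀ + d₁ + (d₂ - d₀) = d₁ + d₂ := by omega
    have e2 : d₀ + d₁ + (d₃ - d₁) = d₀ + d₃ := by omega
    rw [e3, e1, e2]
    have hcoef : ∀ i : Fin 11, (![dJ, w₀ * m₀, w₁ * m₁, w₂ * m₂, w₃ * m₃, w₀ * w₁ * D01, w₀ * w₂ * D02, w₀ * w₃ * D03, w₁ * w₂ * D12, w₁ * w₃ * D13, w₂ * w₃ * D23] : Fin 11 → ℝ) i * (([2 * e, e + d₀, e + d₁, e + d₂, e + d₃, d₀ + d₂, d₁ + d₃]).map (fun ρ : ℕ => ((((![2 * e, e + d₀, e + d₁, e + d₂, e + d₃, d₀ + d₁, d₀ + d₂, d₀ + d₃, d₁ + d₂, d₁ + d₃, d₂ + d₃]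 : Fin 11 → ℕ) i : ℕ) : ℝ) - (ρ : ℝ)))).prod
        = (![0, 0, 0, 0, 0, -A, 0, -C, B, 0, D] : Fin 11 → ℝ) i := by
      intro i
      fin_cases i <;>
        simp only [Fin.zero_eta, Fin.mk_one, Fin.isValue, Matrix.cons_val_zero, Matrix.cons_val_one,
          List.map_cons, List.map_nil, List.prod_cons, List.prod_nil, hA, hB, hC, hD, hPA, hPB, hPC, hPD] <;>
        push_cast <;> ring
    rw [Finset.sum_congr rfl (fun i _ => by rw [hcoef i])]
    simp only [Fin.sum_univ_succ, Fin.sum_univ_zero, Matrix.cons_val_zero, Matrix.cons_val_succ, map_zero, zero_mul,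
      zero_add, add_zero, Polynomial.C_neg]
    ring
  rw [hfour, Polynomial.roots_neg] at hkills
  have hone := card_posRoots_fourNomial_le_one_of_nonneg A B C D hBp hDp hBC (d₀ + d₁) (d₂ - d₀) (d₃ - d₁) (by omega)
  simp only [List.length_cons, List.length_nil] at hkills
  omega


end Summit.ValiantsHypothesis.ValiantsHypothesis.Theorems.LacunarySymmetroidMatrixDescartes.Pivot.TwoDirections.BlockLaw

namespace Summit.ValiantsHypothesis.ValiantsHypothesis.Theorems.LacunarySymmetroidMatrixDescartes.Pivot.RankOneCover

/-! ## 2. Directions: one of (P), (P′) -/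

/-- The Plücker relation for four points on a line. [folklore] -/
theorem pluecker_line (t₀ t₁ t₂ t₃ : ℝ) :
    (t₁ - t₀) * (t₃ - t₂) + (t₃ - t₀) * (t₂ - t₁) = (t₂ - t₀) * (t₃ - t₁) := by ring

/-- **(P) ∨ (P′) on every direction configuration** when `16 N_P ≤ D_P` and `4 N_P′ ≤ D_P′` (`ρ_P ≤ 1/16`, `ρ_P′ ≤ 1/4`). [folklore] -/
theorem cover_P_or_Pprime (t₀ t₁ t₂ t₃ NP DP NP' DP' : ℝ) (hDP : 0 ≤ DP) (hDP' : 0 ≤ DP')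
    (hP : 16 * NP ≤ DP) (hP' : 4 * NP' ≤ DP') :
    NP * ((t₂ - t₁) ^ 2 * (t₃ - t₀) ^ 2) ≤ DP * ((t₁ - t₀) ^ 2 * (t₃ - t₂) ^ 2) ∨
      NP' * ((t₂ - t₁) ^ 2 * (t₃ - t₀) ^ 2) ≤ DP' * ((t₂ - t₀) ^ 2 * (t₃ - t₁) ^ 2) := by
  by_contra h
  push Not at h
  obtain ⟨h1, h2⟩ := h
  obtain ⟨X, hX⟩ : ∃ x : ℝ, x = (t₃ - t₀) * (t₂ - t₁) := ⟨_, rfl⟩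
  obtain ⟨Y, hY⟩ : ∃ x : ℝ, x = (t₁ - t₀) * (t₃ - t₂) := ⟨_, rfl⟩
  obtain ⟨Z, hZ⟩ : ∃ x : ℝ, x = (t₂ - t₀) * (t₃ - t₁) := ⟨_, rfl⟩
  have hXZ : X = Z - Y := by rw [hX, hY, hZ]; ring
  have eX : (t₂ - t₁) ^ 2 * (t₃ - t₀) ^ 2 = X ^ 2 := by rw [hX]; ring
  have eY : (t₁ - t₀) ^ 2 * (t₃ - t₂) ^ 2 = Y ^ 2 := by rw [hY]; ring
  have eZ : (t₂ - t₀) ^ 2 * (t₃ - t₁) ^ 2 = Z ^ 2 := by rw [hZ]; ring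
  rw [eX, eY] at h1
  rw [eX, eZ] at h2
  have hY2 : (4 * Y) ^ 2 < X ^ 2 := by
    nlinarith [mul_le_mul_of_nonneg_left (sq_nonneg Y) hDP, mul_le_mul_of_nonneg_right hP (sq_nonneg X)]
  have hZ2 : (2 * Z) ^ 2 < X ^ 2 := by
    nlinarith [mul_le_mul_of_nonneg_left (sq_nonneg Z) hDP', mul_le_mul_of_nonneg_right hP' (sq_nonneg X)]
  have hYa : |4 * Y| < |X| := sq_lt_sq.mp hY2
  have hZa : |2 * Z| < |X| := sq_lt_sq.mp hZ2
  rw [abs_mul] at hYa hZa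
  have hXle : |X| ≤ |Z| + |Y| := by rw [hXZ]; exact abs_sub _ _
  have h4 : |(4 : ℝ)| = 4 := abs_of_pos (by norm_num)
  have h2' : |(2 : ℝ)| = 2 := abs_of_pos (by norm_num)
  rw [h4] at hYa
  rw [h2'] at hZa
  linarith [abs_nonneg X, abs_nonneg Y, abs_nonneg Z]

/-! ## 3. Directions: one of (S), (S′), (T) -/

/-- **(S) ∨ (S′) ∨ (T) on every configuration `t₀, t₁, t₃ > 0`** when `5000 N_S ≤ D_S`, `25 N_S′ ≤ 3 D_S′`, `16 N_S′N_T ≤ D_S′D_T`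
(`ρ_S ≤ 1/5000`, `ρ_S′ ≤ 3/25`, `ρ_S′ρ_T ≤ 1/16`). [folklore] -/
theorem cover_S_Sprime_T (t₀ t₁ t₃ NS DS NS' DS' NT DT : ℝ) (ht₀ : 0 < t₀) (ht₁ : 0 < t₁) (ht₃ : 0 < t₃)
    (hDS : 0 ≤ DS) (hDS' : 0 < DS') (hDT : 0 < DT) (hNT : 0 ≤ NT)
    (hS : 5000 * NS ≤ DS) (hS' : 25 * NS' ≤ 3 * DS') (hS'T : 16 * (NS' * NT) ≤ DS' * DT) :
    NS * (t₁ * (t₃ - t₀) ^ 2) ≤ DS * (t₃ * (t₁ - t₀) ^ 2) ∨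
      NS' * (t₁ * (t₃ - t₀) ^ 2) ≤ DS' * (t₀ * (t₃ - t₁) ^ 2) ∨
        NT * (4 * (t₀ * t₁)) ≤ DT * (t₁ - t₀) ^ 2 := by
  by_contra h
  push Not at h
  obtain ⟨h1, h2, h3⟩ := h
  -- the two ratios
  obtain ⟨ρ, hρ⟩ : ∃ x : ℝ, x = NS' / DS' := ⟨_, rfl⟩
  obtain ⟨τ, hτ⟩ : ∃ x : ℝ, x = NT / DT := ⟨_, rfl⟩
  have hNS' : NS' = ρ * DS' := by rw [hρ]; field_simp
  have hNT' : NT = τ * DT := by rw [hτ]; field_simp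
  have hτ0 : 0 ≤ τ := by rw [hτ]; positivity
  have hρ1 : ρ ≤ 3 / 25 := by
    rw [hρ, div_le_iff₀ hDS']; linarith
  have hρτ : ρ * τ ≤ 1 / 16 := by
    have e1 : 16 * (ρ * τ) * (DS' * DT) = 16 * (NS' * NT) := by rw [hNS', hNT']; ring
    have h16 : 16 * (ρ * τ) * (DS' * DT) ≤ 1 * (DS' * DT) := by rw [e1, one_mul]; exact hS'T
    have := le_of_mul_le_mul_right h16 (mul_pos hDS' hDT)
    linarith
  have hc : ρ * (2 + 4 * τ) ≤ 49 / 100 := by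
    have e : ρ * (2 + 4 * τ) = 2 * ρ + 4 * (ρ * τ) := by ring
    rw [e]; linarith
  -- the three failures, normalised
  have F1 : 5000 * (t₃ * (t₁ - t₀) ^ 2) < t₁ * (t₃ - t₀) ^ 2 := by
    by_contra hc1
    push Not at hc1
    have a1 : DS * (t₁ * (t₃ - t₀) ^ 2) ≤ DS * (5000 * (t₃ * (t₁ - t₀) ^ 2)) := mul_le_mul_of_nonneg_left hc1 hDS
    have a2 : 5000 * NS * (t₁ * (t₃ - t₀) ^ 2) ≤ DS * (t₁ * (t₃ - t₀) ^ 2) :=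
      mul_le_mul_of_nonneg_right hS (by positivity)
    linarith
  have F2 : t₀ * (t₃ - t₁) ^ 2 < ρ * (t₁ * (t₃ - t₀) ^ 2) := by
    rw [hNS'] at h2
    have : DS' * (t₀ * (t₃ - t₁) ^ 2) < DS' * (ρ * (t₁ * (t₃ - t₀) ^ 2)) := by linarith
    exact lt_of_mul_lt_mul_left this hDS'.le
  have F3 : (t₁ - t₀) ^ 2 < τ * (4 * (t₀ * t₁)) := by
    rw [hNT'] at h3
    have : DT * (t₁ - t₀) ^ 2 < DT * (τ * (4 * (t₀ * t₁))) := by linarith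
    exact lt_of_mul_lt_mul_left this hDT.le
  -- (T) fails only if neither t₁ ≥ (2 + 4τ) t₀ nor t₀ ≥ (2 + 4τ) t₁
  have notfar₁ : ¬ ((2 + 4 * τ) * t₀ ≤ t₁) := by
    intro hle
    have : 0 ≤ t₁ * (t₁ - (2 + 4 * τ) * t₀) := mul_nonneg ht₁.le (by linarith)
    linarith [sq_nonneg t₀]
  have notfar₀ : ¬ ((2 + 4 * τ) * t₁ ≤ t₀) := by
    intro hle
    have : 0 ≤ t₀ * (t₀ - (2 + 4 * τ) * t₁) := mul_nonneg ht₀.le (by linarith)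
    linarith [sq_nonneg t₁]
  have hρ0 : 0 < ρ := by
    by_contra hc0
    push Not at hc0
    have : ρ * (t₁ * (t₃ - t₀) ^ 2) ≤ 0 := mul_nonpos_of_nonpos_of_nonneg hc0 (by positivity)
    have : 0 ≤ t₀ * (t₃ - t₁) ^ 2 := by positivity
    linarith
  have h24 : 0 < 2 + 4 * τ := by positivity
  rcases le_or_gt t₁ (50 * t₃) with hI | hII
  · -- Case I: t₁ ≤ 50 t₃
    have G1 : 100 * (t₁ - t₀) ^ 2 < (t₃ - t₀) ^ 2 := by
      have a1 : t₁ * (t₃ - t₀) ^ 2 ≤ 50 * t₃ * (t₃ - t₀) ^ 2 :=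
        mul_le_mul_of_nonneg_right hI (sq_nonneg _)
      have a2 : (50 * t₃) * (100 * (t₁ - t₀) ^ 2) < (50 * t₃) * (t₃ - t₀) ^ 2 := by linarith
      exact lt_of_mul_lt_mul_left a2 (by positivity)
    have G1a : |10 * (t₁ - t₀)| < |t₃ - t₀| := by
      refine sq_lt_sq.mp ?_
      have e : (10 * (t₁ - t₀)) ^ 2 = 100 * (t₁ - t₀) ^ 2 := by ring
      rw [e]; exact G1
    rw [abs_mul, abs_of_pos (by norm_num : (0:ℝ) < 10)] at G1a
    have tri : |t₃ - t₀| ≤ |t₃ - t₁| + |t₁ - t₀| := by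
      have e : t₃ - t₀ = (t₃ - t₁) + (t₁ - t₀) := by ring
      rw [e]; exact abs_add_le _ _
    have G2a : (9 / 10) * |t₃ - t₀| < |t₃ - t₁| := by linarith
    have G2 : (81 / 100) * (t₃ - t₀) ^ 2 < (t₃ - t₁) ^ 2 := by
      have h9 : 0 ≤ (9 / 10) * |t₃ - t₀| := by positivity
      have := pow_lt_pow_left₀ G2a h9 two_ne_zero
      rw [mul_pow, sq_abs, sq_abs] at this
      norm_num at this
      linarith
    have hpos : 0 < (t₃ - t₀) ^ 2 := by linarith [sq_nonneg (t₁ - t₀)]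
    have K1 : 81 * t₀ < 100 * (ρ * t₁) := by
      have a1 : t₀ * ((81 / 100) * (t₃ - t₀) ^ 2) < t₀ * (t₃ - t₁) ^ 2 := mul_lt_mul_of_pos_left G2 ht₀
      have a2 : (81 * t₀) * (t₃ - t₀) ^ 2 < (100 * (ρ * t₁)) * (t₃ - t₀) ^ 2 := by linarith
      exact lt_of_mul_lt_mul_right a2 hpos.le
    refine notfar₁ ?_
    have b1 := mul_lt_mul_of_pos_left K1 h24
    have b2 := mul_le_mul_of_nonneg_left hc (show (0:ℝ) ≤ 100 * t₁ by positivity)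
    linarith
  · -- Case II: 50 t₃ < t₁
    have G3 : 2401 * t₁ ^ 2 ≤ 2500 * (t₃ - t₁) ^ 2 := by
      have d : (49 / 50) * t₁ ≤ t₁ - t₃ := by linarith
      have := pow_le_pow_left₀ (by positivity) d 2
      have e : (t₃ - t₁) ^ 2 = (t₁ - t₃) ^ 2 := by ring
      rw [mul_pow] at this
      norm_num at this
      rw [e]; linarith
    rcases le_or_gt t₀ t₁ with h01 | h10
    · have G4 : (t₃ - t₀) ^ 2 ≤ t₁ ^ 2 := by
        nlinarith [mul_pos (show 0 < t₁ - t₃ + t₀ by linarith) (show 0 < t₁ + t₃ - t₀ by linarith)]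
      have K2 : 2401 * t₀ < 2500 * (ρ * t₁) := by
        have a1 := mul_le_mul_of_nonneg_left G3 ht₀.le
        have a2 : ρ * (t₁ * (t₃ - t₀) ^ 2) ≤ ρ * (t₁ * t₁ ^ 2) :=
          mul_le_mul_of_nonneg_left (mul_le_mul_of_nonneg_left G4 ht₁.le) hρ0.le
        have a3 : (2401 * t₀) * t₁ ^ 2 < (2500 * (ρ * t₁)) * t₁ ^ 2 := by linarith
        exact lt_of_mul_lt_mul_right a3 (sq_nonneg _)
      refine notfar₁ ?_
      have b1 := mul_lt_mul_of_pos_left K2 h24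
      have b2 := mul_le_mul_of_nonneg_left hc (show (0:ℝ) ≤ 2500 * t₁ by positivity)
      linarith
    · have G5 : (t₃ - t₀) ^ 2 ≤ t₀ ^ 2 := by
        nlinarith [mul_pos ht₃ (show 0 < 2 * t₀ - t₃ by linarith)]
      have K3 : 2401 * t₁ < 2500 * (ρ * t₀) := by
        have a1 := mul_le_mul_of_nonneg_left G3 ht₀.le
        have a2 : ρ * (t₁ * (t₃ - t₀) ^ 2) ≤ ρ * (t₁ * t₀ ^ 2) :=
          mul_le_mul_of_nonneg_left (mul_le_mul_of_nonneg_left G5 ht₁.le) hρ0.le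
        have a3 : (2401 * t₁) * (t₀ * t₁) < (2500 * (ρ * t₀)) * (t₀ * t₁) := by linarith
        exact lt_of_mul_lt_mul_right a3 (by positivity)
      refine notfar₀ ?_
      have b1 := mul_lt_mul_of_pos_left K3 h24
      have b2 := mul_le_mul_of_nonneg_left hc (show (0:ℝ) ≤ 2500 * t₀ by positivity)
      linarith

end Summit.ValiantsHypothesis.ValiantsHypothesis.Theorems.LacunarySymmetroidMatrixDescartes.Pivot.RankOneCover
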